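import Literature.MathematicalPhysics.QuantumFieldTheory.Balaban1983to89.B12Ext436Lattice
import Literature.MathematicalPhysics.QuantumFieldTheory.Balaban1983to89.B12Moments443
import Literature.MathematicalPhysics.QuantumFieldTheory.Balaban1983to89.B12Covariance54

/-!
# Bałaban CMP 109 (1987) §5 p. 293, (5.8): «The function Π is also translation invariant and symmetric, hence
Π_{μν}(x, y) = Π_{μν}(x − y), Π_{μν}(x) = Π_{νμ}(−x)» — the passage from the TWO-VARIABLE vacuum polarization
kernel Π(x, y) of (4.37)/(5.1) to the ONE-VARIABLE kernel Π(x − y) of (5.10)–(5.47), typed as bookkeeping from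
(5.1) (Π = limit of finite-volume Hessians, NAMED HYPOTHESIS) + (5.2)/(5.3) (translation invariance of the
finite-volume functional) + the symmetry of second derivatives; and the JOIN of the two-variable kernel with the
lineage's one-variable moment kernels (4.43)/(4.45) (`…B12Moments443`) and decay predicate (5.10) (`…B12Sec2to5`)

CITATION HEADER (lean-in-tree rule 2026-08-18).
* Source: T. Bałaban, "Renormalization group approach to lattice gauge field theories. I. Generation of effective
  actions in a small field approximation and a coupling constant renormalization in four dimensions", Commun. Math.
  Phys. **109** (1987) 249–301, doi:10.1007/bf01215223 [Balaban1987RG1] (cell paper B12; held: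
  `paper:balaban1987-cmp109-rg-i-small-field`; PDF page = journal page − 248), §1 p. 264 (1.20)–(1.21), §4 p. 291
  (4.37), §5 pp. 292–293 (5.1)–(5.5), (5.8), (5.10).  The sentences and displays quoted below were READ AS IMAGES by
  the author of this file on the 300-dpi renders of the audit cell (`HOME/b2b-balaban-ref1/pages/1987-cmp109-rg-I-
  small-field/…-p016-x2.png` = p. 264, `…-p043-x2.png` = p. 291, `…-p044-x2.png` = p. 292, `…-p045-x2.png` = p. 293;
  HOME = the cell folder `run/shared/lean/pub/pub-balaban/`) and agree with the lineage transcript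
  `HOME/b2b-balaban-b03/B12s-transcript.md`;
  inside quotation marks nothing is altered.  Audit cell `pub-balaban`, unit `b2b-balaban-b03-g17` (PAPER SUB-CELL
  B03 → B12 §§2–5 lineage, gen 17), node B12-TRANSL-58.  Imports only the lineage's own accepted modules
  `…B12Ext436Lattice` (the class 𝐃⁰_j of ℤᵈ, `LDom`, and (4.37)/(5.10) `twoPoint_latt`), `…B12Moments443` ((4.43),
  (4.45) for the one-variable Π) and `…B12Covariance54` (§7 there: `hessian_invariant`, the abstract (5.2) ⇒ (5.4));
  modifies nothing.
* Statements reproduced (verbatim).  p. 292 [PDF 44], opening of Sect. 5: *"The vacuum polarization tensor is defined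
  by the formula (4.37) of the previous section. From this it follows that it can be defined also as"* (5.1)
  *"Π(b, b′) = lim_{T₁^{(j)}↗Z⁴} δ²/(δB(b)δB(b′)) 𝐄^{(j)}(U_j(exp iB))|_{B=0}. This representation is basic for the
  further analysis, because it implies symmetries of the tensor. The function 𝐄^{(j)}(U_j(exp iB)) is invariant with
  respect to all Euclidean symmetries r of the lattice T₁^{(j)},"* (5.2) *"𝐄^{(j)}(U_j(exp irB)) = 𝐄^{(j)}(rU_j(exp iB))
  = 𝐄^{(j)}(U_j(exp iB)), where the fields rU, rB are defined by the identity (rU)(rb) = U(b), hence"* (5.3)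
  *"(rU)(b) = U(r⁻¹b), (rB)(b) = B(r⁻¹b). The invariance (5.2) yields the following covariant transformation law for
  the polarization tensor:"* (5.4) *"Π(rb, rb′) = Π(b, b′),"* … *"We would like to get the representation (4.41) for
  the function"* (5.5) *"Π_{μν}(x, y) = Π(⟨x, x + e_μ⟩, ⟨y, y + e_ν⟩)."*  p. 293 [PDF 45]: *"The function Π is also
  translation invariant and symmetric, hence"* (5.8) *"Π_{μν}(x, y) = Π_{μν}(x − y), Π_{μν}(x) = Π_{νμ}(−x)."* and
  *"The representation (4.37) yields the following inequality"* (5.10) *"|Π_{μν}(x − y)| ≦ O(1)E₀ exp(−δ₁|x − y|),"*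
  … *"This property is the basic reason why we have taken the infinite volume limit in (5.1)."*  p. 264 [PDF 16]:
  *"We define"* (1.20) *"Π^{ab}_{j+1,μν}(g_j, x, x′) = (δ²/(δB^a_μ(x)δB^b_ν(x′)) 𝐄^{(j+1)})(g_j, 0). This is the
  vacuum polarization tensor of the theory defined by the j-th fluctuation field integral."* … *"By the Euclidean
  invariance of 𝐄^{(j+1)} the function (1.20) is Euclidean covariant. This implies"* (1.21) *"Π^{ab}_{j+1,μν}(g_j, x, x′)
  = δ^{ab}Π_{j+1,μν}(g_j, x − x′), Π_{j+1}(g_j, rb, rb′) = Π_{j+1}(g_j, b, b′), where Π_{j+1,μν}(g_j, x) is a real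
  valued function, and r is a Euclidean rotation leaving the lattice T^{(j+1)} invariant. Now we take a limit of
  these functions as T^{(j+1)}↗Z^d. This limit exists by the localized representation (1.7)."*  p. 291 [PDF 43]:
  *"Thus, after all the changes and resummations, we obtain an expression which is equal to this in (4.34), with the
  function 𝐄^{(2)}_{μ,ν}(X, x, y) replaced by"* (4.37) *"Π_{μ,ν}(x, y) = Σ_{X∈𝐃⁰_j} 𝐄^{(2)}_{μ,ν}(X, x, y),"* … *"The
  function Π is called the vacuum polarization tensor. We will investigate it in the next section."*  p. 292 [PDF 44],
  end of Sect. 4, after (4.45): *"hence this term vanishes."* … *"The corresponding terms from (4.34) are equal to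
  (4.42), (4.44) also,"* (the sentences served by §4 below, through `…B12Moments443`).
* Proof route.  Print states (5.8) in one sentence («is also translation invariant and symmetric, hence») and
  (1.21)₁ in one word («implies»), with no displayed argument; the standard argument is: translations `r = τ_a` of
  the torus are among the Euclidean symmetries of (5.2), so (5.4) for `r = τ_a` reads `Π(x + a, y + a) = Π(x, y)`
  (finite volume), which passes to the limit (5.1); a function of two lattice points invariant under simultaneous
  translation is a function of the difference; and a Hessian is a symmetric bilinear form.  This module supplies
  exactly that, as elementary algebra/analysis (the author of this file's own three-line arguments, `[folklore]`),
  with the printed identification (5.1) entering ONLY as the named hypothesis `hlim` (a pointwise limit along an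
  arbitrary non-trivial filter of volumes, cf. `…B12Limit51`), and the printed invariance (5.2) ONLY as the named
  hypothesis `hinv` on an abstract `C²` function of the finite-volume field.

WHY THIS NODE (the DAG edge it closes).  Every one-variable module of the lineage — `…B12Sec2to5.Decay510`
((5.10)), `…B12Beta.Kernel` ((1.21)/(1.22)), `…B12Transverse536`/`…B12Form543`/`…B12Covariance54` ((5.6)–(5.9),
(5.43): "(5.8)₁ is built into `form`", header of `…B12Covariance54`), `…B12Moments443`/`…B12WholeLattice290`
((4.43), (4.45) for Π) — STARTS from a kernel `Π_{μν}(x − y)`, whereas the §4 chain `…B12Chain290` (p. 290 →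
(4.37)) ENDS with the two-variable `Π(x, y) = Σ'_{X∈𝐃⁰_j(ℤᵈ)} 𝐄²(X, x, y)` and whole-lattice sums
`Σ_{y∈ℤᵈ} Π(x, y)·{1, (y − x)_κ, (y − x)_κ(y − x)_λ}`.  The sentence (5.8) is the bridge; it was nowhere typed.
A TERMWISE covariance `𝐄²(X + a, x + a, y + a) = 𝐄²(X, x, y)` would NOT give it (the cube partition π_j behind
𝐃⁰_j is invariant only under translations by multiples of the cube size, so termwise one gets M-periodicity, not
(5.8)₁); print's route through the TOTAL functional (5.1)/(5.2) is the one typed here.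

DICTIONARY (paper ↦ Lean).
* the torus `T₁^{(j)}` (or `T^{(j+1)}` in (1.21)) ↦ an arbitrary additive commutative group `T` of sites (finite in
  §2, where the field space must be a normed space); the lattice `Z^d` ↦ `Pt d = Fin d → ℤ` (`…PeriodicGleason.Pt`);
  the family of volumes `T₁^{(j)}↗Z⁴` ↦ an index type `ι` with a non-trivial filter `l` (e.g. `atTop` on `ℕ`, or a
  subsequence, `…B12Limit51`) and additive homomorphisms `π n : Pt d →+ Tn n` (reduction modulo the periods).
* a bond field `B` on positively oriented bonds, `B_μ(y) = B(⟨y, y + e_μ⟩)` ((5.5)) with values in a normed space `V`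
  (the Lie algebra; `V = 𝕜` for one colour component) ↦ `B : Λ → T → V` (`Λ` = directions, `Fin d` in print); the
  translation `r = τ_a`, `r⟨y, y + e_μ⟩ = ⟨y + a, y + a + e_μ⟩`, acting by (5.3) `(rB)(b) = B(r⁻¹b)` ↦
  `(τ_a B)_μ(y) = B_μ(y − a)` (`exists_translateCLM`: a continuous linear map of the field space);
  `δ/δB_μ(x)` in the direction `v ∈ V` ↦ the Fréchet derivative in the direction `Pi.single μ (Pi.single x v)`.
* `𝐄^{(j)}(U_j(exp iB))` as a function of `B` ↦ an abstract `f : (Λ → T → V) → F`, `C²` (`hf`); (5.2) for the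
  translations ↦ `hinv : ∀ a B, f (τ_a B) = f B`; the finite-volume tensor (1.20)/(5.1)-before-the-limit
  `δ²f/δB_μ(x)δB_ν(y)|_{B=0}` ↦ `fderiv 𝕜 (fderiv 𝕜 f) 0 (Pi.single μ (Pi.single x v)) (Pi.single ν (Pi.single y w))`
  (the `fderiv ∘ fderiv` spelling of `…B12Ward414`, `…B12Covariance54` §7).
* "translation invariant" (of a two-variable kernel) ↦ `∀ a x y, Π (x + a) (y + a) = Π x y`; "symmetric" ↦
  `∀ μ ν x y, Π μ ν x y = Π ν μ y x`; (5.8)₁ ↦ `Π μ ν x y = Π μ ν (x − y) 0`, i.e. the one-variable kernel is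
  `K μ ν z := Π μ ν z 0` (`translationInvariant_iff_exists_kernel`, `kernel_eq`: it is the only one); (5.8)₂ ↦
  `K μ ν z = K ν μ (−z)` — LITERALLY the left member of `…B12Covariance54.symmetric_iff` and the hypothesis shape of
  the lineage; (5.1) ↦ `hlim : ∀ μ ν x y, Tendsto (fun n ↦ Πv n μ ν (π n x) (π n y)) l (𝓝 (Π μ ν x y))`.
* the lineage's one-variable conventions: `…B12Moments443.M0x/M1x/M2x Pc x …` sum `Pc μ ν (x − y)·(…)` over `y`, so
  `Pc = ofRealK K` with `K z = Π(z, 0)` (`ofReal_tsum_moment2_eq_M2x` & co.); `…B12Ext436Lattice.decay510_latt` bounds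
  `z ↦ Π(0, z) = K(−z)` (`apply_zero_eq`, `decay510_neg_iff`: (5.10) is insensitive to the reflection).

WHAT IS PROVED (kernel-checked, no `sorry`, standard axioms; every declaration is `[folklore]` algebra/analysis ABOUT
the printed objects, or carries the printed locus it transcribes).
1. §1 (any additive commutative group): `apply_eq_apply_sub_zero` (translation invariance ⇒ `Π x y = Π (x − y) 0`),
   `apply_eq_apply_zero_sub`, `apply_zero_eq`, `translationInvariant_iff_exists_kernel` ((5.8)₁ ⇔ ∃ one-variable
   kernel), `kernel_eq` (uniqueness), `swap_kernel` (translation invariance + symmetry ⇒ (5.8)₂ `K μ ν z = K ν μ (−z)`),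
   `translationInvariant_comp` (pull-back along `π : Z^d →+ T`), and the limit lemmas `translationInvariant_of_tendsto`,
   `swap_of_tendsto` (both properties are closed under pointwise limits in a Hausdorff space, along any `NeBot` filter).
2. §2 (finite volume, (5.2) ⇒ (5.4) ⇒ (1.21)/(5.8) before the limit): `hessian_translate` (abstract: a family of
   continuous linear maps `τ_a` with `f ∘ τ_a = f` and `τ_a e_{μ,x} = e_{μ,x+a}` ⇒ the Hessian kernel in the directions
   `e` is translation invariant), `hessian_swap` (over `ℝ`/`ℂ` a `C²` function has a symmetric second derivative —
   Mathlib `ContDiffAt.isSymmSndFDerivAt`), `exists_translateCLM` + `hessian_translate_pi` (the concrete field space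
   `Λ → T → V` with (5.3)), `eq121_finiteVolume` ((1.21)₁ and (5.8)₂ on the torus for the Hessian kernel `H`).
3. §3 (the limit (5.1)): `transl58_of_limit` — finite-volume translation invariance and symmetry + the pointwise
   limit (5.1) through the projections `π n` ⇒ the limit kernel on `Z^d` (any group) is translation invariant and
   symmetric; `eq58_of_limit` — hence (5.8) as printed: `Π μ ν x y = Π μ ν (x − y) 0` and `Π μ ν z 0 = Π ν μ (−z) 0`.
4. §4 (the JOIN on ℤᵈ with the lineage's one-variable objects, under translation invariance `hT` of the two-variable
   family, whatever its provenance): `decay510_kernel_of_twoPoint` / `decay510_neg_iff` / `decay510_tsum437` ((5.10) for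
   `K = Π(·, 0)` from a two-point bound, in particular from `…B12Ext436Lattice.twoPoint_latt` for (4.37));
   `ofReal_tsum_moment2_eq_M2x`, `…moment1_eq_M1x`, `…moment0_eq_M0x`, `ofReal_kdA` (the whole-lattice coefficient sums
   `Σ_y Π_{μν}(x, y)(y − x)_κ(y − x)_λ` etc. — the right members reached by `…B12Chain290.chain290_moment2/1/0` — ARE
   the lineage's `M2x/M1x/M0x (ofRealK K) x …`); `moment2_eq_of_symmetries`, `moment1_eq_zero_of_symmetries`,
   `moment0_eq_zero_of_symmetries` ((4.43), (4.45), `Σ_yΠ = 0` for the TWO-VARIABLE Π, as REAL identities, from (5.6)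
   `PermCovariant`, (5.7) `ReflCovariant`, (5.9)₁ `WardFirst`, (5.10) `Decay510` of `K`, via
   `…B12Moments443.moments443_of_symmetries` & co.); the plug lemmas `abs_sub_moment2_le_of_symmetries`,
   `abs_moment1_le_of_symmetries`, `abs_moment0_le_of_symmetries` (any real `A` within `ε` of the whole-lattice sum is
   within `ε` of `β(δ_{μκ}δ_{νλ} + δ_{μλ}δ_{νκ} − 2δ_{μν}δ_{κλ})`, resp. of `0` — with `A`, `ε` the left member and the
   three-term bound of `chain290_moment2/1/0` this is p. 292 «equal to (4.42), (4.44) also» for the restricted sums of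
   (4.34), now for print's Π(x, y) itself); and the end-to-end `moment2_eq_of_limit` ((5.1) + finite-volume (5.2)-for-
   translations + Hessian symmetry + the §5 symmetries and decay of `K` ⇒ (4.43) for the two-variable limit kernel).

WHAT IS NOT PROVED HERE (and not claimed).  (5.2) itself and the existence of the limit (5.1) (hypotheses `hinv`,
`hlim`, exactly as asserted in print: «This limit exists by the localized representation (1.7)»; subsequential
existence under uniform bounds is `…B12Limit51`); the identification of `Σ_{X∈𝐃⁰_j}𝐄²(X, x, y)` ((4.37), the object of
`…B12Chain290`) with the limit (5.1) of the torus Hessians («it can be defined also as») — in §4 translation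
invariance of that series is the hypothesis `hT`, to be discharged through §3 from `hlim`; (5.4) ⇒ (5.6), (5.7) for
rotations and reflections at the two-variable level (the one-variable dictionary is `…B12Covariance54`); the colour
structure `δ^{ab}` of (1.21)₁ (global gauge invariance; here `v, w ∈ V` are fixed charge directions); uniqueness /
full-sequence convergence in (5.1).

HONEST FRAMING: value = kernel certificate of one sentence of printed bookkeeping ((5.8), and (1.21)₁ at finite volume)
plus one by-name join inside the lineage's DAG (two-variable (4.37) ↔ one-variable (4.43)/(5.10)); NOT a reproduction of
any estimate of the paper, NOT summit progress (the host summit — continuum Yang–Mills with mass gap — is untouched).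
-/

namespace Literature.MathematicalPhysics.QuantumFieldTheory.Balaban1983to89.B12Transl58

open Literature.MathematicalPhysics.QuantumFieldTheory.GawedzkiKupiainen1985.PeriodicGleason (Pt)
open Literature.MathematicalPhysics.QuantumFieldTheory.Balaban1983to89.B12Sec2to5 (l1 Decay510)
open Literature.MathematicalPhysics.QuantumFieldTheory.Balaban1983to89.B12Decay510 (delta1)
open Literature.MathematicalPhysics.QuantumFieldTheory.Balaban1983to89.B12Decay510Window (K₁ l1_neg)
open Literature.MathematicalPhysics.QuantumFieldTheory.Balaban1983to89.B12TreeDecay (kappa₀ K₀)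
open Literature.MathematicalPhysics.QuantumFieldTheory.Balaban1983to89.B12Ext436Lattice (LDom geomZ twoPoint_latt)
open Literature.MathematicalPhysics.QuantumFieldTheory.Balaban1983to89.B12Rep537 (ofReal)
open Literature.MathematicalPhysics.QuantumFieldTheory.Balaban1983to89.B12Form543 (ofRealK)
open Literature.MathematicalPhysics.QuantumFieldTheory.Balaban1983to89.B12Transverse536 (ReflCovariant WardFirst)
open Literature.MathematicalPhysics.QuantumFieldTheory.Balaban1983to89.B12Marginal444 (kdA)
open Literature.MathematicalPhysics.QuantumFieldTheory.Balaban1983to89.B12Moments443 (M0x M1x M2x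
  moments443_of_symmetries moments445_of_symmetries moments0_of_symmetries)
open Literature.MathematicalPhysics.QuantumFieldTheory.Balaban1983to89.B12Covariance54 (hessian_invariant)
open Filter
open _root_.Topology

/-! ## §1 Two-variable kernels invariant under simultaneous translation: (5.8)₁ ⇔ a function of x − y; (5.8)₂ -/

section TwoVariable

variable {G : Type*} [AddCommGroup G] {α : Type*}

/-- **(5.8)₁, the algebra**: a kernel of two lattice points invariant under simultaneous translation of both arguments
depends on the difference only, `Π(x, y) = Π(x − y, 0)` («Π_{μν}(x, y) = Π_{μν}(x − y)» with the one-variable kernel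
`K(z) := Π(z, 0)`). [folklore] (about (5.8) p.293 / (1.21) p.264 of Balaban1987RG1) -/
theorem apply_eq_apply_sub_zero {P : G → G → α} (hT : ∀ a x y, P (x + a) (y + a) = P x y) (x y : G) :
    P x y = P (x - y) 0 := by
  rw [← hT (-y) x y, ← sub_eq_add_neg, add_neg_cancel]

/-- The same with the first argument moved to the origin: `Π(x, y) = Π(0, y − x)`. [folklore] -/
theorem apply_eq_apply_zero_sub {P : G → G → α} (hT : ∀ a x y, P (x + a) (y + a) = P x y) (x y : G) :
    P x y = P 0 (y - x) := by
  rw [← hT (-x) x y, add_neg_cancel, ← sub_eq_add_neg]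

/-- `Π(0, z) = Π(−z, 0)`: the kernel `z ↦ Π(0, z)` (the one bounded in `…B12Ext436Lattice.decay510_latt`) is the
reflection of `K(z) = Π(z, 0)`. [folklore] -/
theorem apply_zero_eq {P : G → G → α} (hT : ∀ a x y, P (x + a) (y + a) = P x y) (z : G) :
    P 0 z = P (-z) 0 := by
  rw [apply_eq_apply_sub_zero hT, zero_sub]

/-- **(5.8)₁ as an equivalence**: translation invariance of a two-variable kernel ⇔ it is `K(x − y)` for some
one-variable kernel `K`. [folklore] (about (5.8) p.293 of Balaban1987RG1) -/
theorem translationInvariant_iff_exists_kernel (P : G → G → α) :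
    (∀ a x y, P (x + a) (y + a) = P x y) ↔ ∃ K : G → α, ∀ x y, P x y = K (x - y) := by
  refine ⟨fun hT => ⟨fun z => P z 0, apply_eq_apply_sub_zero hT⟩, ?_⟩
  rintro ⟨K, hK⟩ a x y
  rw [hK, hK, add_sub_add_right_eq_sub]

/-- The one-variable kernel is unique: necessarily `K(z) = Π(z, 0)`. [folklore] -/
theorem kernel_eq {P : G → G → α} {K : G → α} (hK : ∀ x y, P x y = K (x - y)) (z : G) : K z = P z 0 := by
  rw [hK, sub_zero]

/-- **(5.8)₂, the algebra**: for a family of kernels `Π_{μν}(x, y)` that is translation invariant and symmetric as a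
bilinear form (`Π_{μν}(x, y) = Π_{νμ}(y, x)`, a Hessian), the one-variable kernels `K_{μν}(z) = Π_{μν}(z, 0)` satisfy
«Π_{μν}(x) = Π_{νμ}(−x)» — literally the left member of `…B12Covariance54.symmetric_iff`. [folklore] (about (5.8) p.293
of Balaban1987RG1) -/
theorem swap_kernel {Λ : Type*} {P : Λ → Λ → G → G → α}
    (hT : ∀ μ ν a x y, P μ ν (x + a) (y + a) = P μ ν x y) (hS : ∀ μ ν x y, P μ ν x y = P ν μ y x)
    (μ ν : Λ) (z : G) : P μ ν z 0 = P ν μ (-z) 0 := by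
  rw [hS μ ν z 0, apply_eq_apply_sub_zero (hT ν μ) 0 z, zero_sub]

/-- Pull-back along an additive homomorphism (e.g. the reduction `Z^d → T₁^{(j)}` modulo the periods of the torus): a
translation-invariant kernel on `T` gives a translation-invariant kernel on `Z^d`. [folklore] -/
theorem translationInvariant_comp {H : Type*} [AddCommGroup H] {Φ : Type*} [FunLike Φ G H]
    [AddMonoidHomClass Φ G H] (φ : Φ) {P : H → H → α} (hT : ∀ b x y, P (x + b) (y + b) = P x y)
    (a x y : G) : P (φ (x + a)) (φ (y + a)) = P (φ x) (φ y) := by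
  rw [map_add, map_add, hT]

variable [TopologicalSpace α] [T2Space α] {ι : Type*} {l : Filter ι} [l.NeBot]

/-- **Translation invariance passes to pointwise limits** (Hausdorff values, any non-trivial filter of volumes — full
sequence or subsequence). [folklore] (the step (5.4)-at-finite-volume ⇒ (5.8)₁ through the limit (5.1) p.292 of
Balaban1987RG1) -/
theorem translationInvariant_of_tendsto {Pn : ι → G → G → α} {P : G → G → α}
    (hTn : ∀ n a x y, Pn n (x + a) (y + a) = Pn n x y)
    (hlim : ∀ x y, Tendsto (fun n => Pn n x y) l (𝓝 (P x y))) (a x y : G) :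
    P (x + a) (y + a) = P x y :=
  tendsto_nhds_unique ((hlim (x + a) (y + a)).congr fun n => hTn n a x y) (hlim x y)

/-- **Symmetry passes to pointwise limits.** [folklore] (the step Hessian-symmetry-at-finite-volume ⇒ (5.8)₂ through
the limit (5.1) p.292 of Balaban1987RG1) -/
theorem swap_of_tendsto {Λ X : Type*} {Pn : ι → Λ → Λ → X → X → α} {P : Λ → Λ → X → X → α}
    (hSn : ∀ n μ ν x y, Pn n μ ν x y = Pn n ν μ y x)
    (hlim : ∀ μ ν x y, Tendsto (fun n => Pn n μ ν x y) l (𝓝 (P μ ν x y))) (μ ν : Λ) (x y : X) :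
    P μ ν x y = P ν μ y x :=
  tendsto_nhds_unique ((hlim μ ν x y).congr fun n => hSn n μ ν x y) (hlim ν μ y x)

end TwoVariable

/-! ## §2 Finite volume: (5.2) for the translations ⇒ (5.4) ⇒ (1.21)₁/(5.8) for the Hessian kernel on the torus -/

section Hessian

variable {𝕜 : Type*} [NontriviallyNormedField 𝕜] {E F : Type*} [NormedAddCommGroup E] [NormedSpace 𝕜 E]
  [NormedAddCommGroup F] [NormedSpace 𝕜 F]

/-- **(5.2) ⇒ (5.4) for the translations, abstract field space**: if the `C²` function `f` («𝐄^{(j)}(U_j(exp iB))» as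
a function of `B`) is invariant under a family of continuous linear maps `τ_a` («rB», (5.3)) which move the bond
directions by `τ_a e_{μ,x} = e_{μ,x+a}`, then its Hessian at `0` in the bond directions («Π(b, b′)», (5.1) before the
limit, (1.20)) is invariant under simultaneous translation: «Π(rb, rb′) = Π(b, b′)».
[cite: Balaban1987RG1, (5.2)-(5.4) p.292; (1.20)-(1.21) p.264] -/
theorem hessian_translate {T Λ : Type*} [AddCommGroup T] {f : E → F} (hf : ContDiff 𝕜 2 f)
    (τ : T → E →L[𝕜] E) (hinv : ∀ a, f ∘ τ a = f) (e : Λ → T → E)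
    (he : ∀ a μ x, τ a (e μ x) = e μ (x + a)) (μ ν : Λ) (a x y : T) :
    fderiv 𝕜 (fderiv 𝕜 f) 0 (e μ (x + a)) (e ν (y + a)) = fderiv 𝕜 (fderiv 𝕜 f) 0 (e μ x) (e ν y) := by
  rw [← he a μ x, ← he a ν y]
  exact hessian_invariant hf (τ a) (hinv a) (e μ x) (e ν y)

/-- **«symmetric»**: over `ℝ` or `ℂ` the second derivative of a `C²` function is a symmetric bilinear form
(Schwarz; Mathlib `ContDiffAt.isSymmSndFDerivAt`), so the finite-volume tensor satisfies
`Π(b, b′) = Π(b′, b)`. [folklore] (the word «symmetric» of (5.8) p.293, Balaban1987RG1) -/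
theorem hessian_swap [IsRCLikeNormedField 𝕜] {f : E → F} (hf : ContDiffAt 𝕜 2 f 0) (v w : E) :
    fderiv 𝕜 (fderiv 𝕜 f) 0 v w = fderiv 𝕜 (fderiv 𝕜 f) 0 w v :=
  hf.isSymmSndFDerivAt (by simp) v w

variable {Λ T V : Type*} [AddCommGroup T] [NormedAddCommGroup V] [NormedSpace 𝕜 V]

/-- **(5.3) for a translation `r = τ_a` of the torus is a continuous linear map of the finite-volume field space**:
`(rB)(b) = B(r⁻¹b)`, i.e. `(τ_a B)_μ(y) = B_μ(y − a)` for bond fields `B_μ(y) = B(⟨y, y + e_μ⟩)` with values in the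
charge space `V`. [cite: Balaban1987RG1, (5.3) p.292] -/
theorem exists_translateCLM (a : T) :
    ∃ τ : (Λ → T → V) →L[𝕜] (Λ → T → V), ∀ B μ y, τ B μ y = B μ (y - a) :=
  ⟨{ toFun := fun B μ y => B μ (y - a)
     map_add' := fun _ _ => rfl
     map_smul' := fun _ _ => rfl
     cont := continuous_pi fun μ => continuous_pi fun y =>
       (continuous_apply (y - a)).comp (continuous_apply μ) }, fun _ _ _ => rfl⟩

variable [Fintype Λ] [Fintype T] [DecidableEq Λ] [DecidableEq T]

/-- **(5.2) ⇒ (5.4) for the translations on the concrete field space** `B : Λ → T → V`: if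
`f(τ_a B) = f(B)` for all `a` ((5.2) with (5.3)) and `f ∈ C²`, the Hessian kernel in the bond directions
`δ/δB_μ(x)` (charge direction `v`) and `δ/δB_ν(y)` (charge direction `w`) is invariant under `(x, y) ↦ (x + a, y + a)`.
[cite: Balaban1987RG1, (5.2)-(5.4) p.292; (1.21) p.264] -/
theorem hessian_translate_pi {f : (Λ → T → V) → F} (hf : ContDiff 𝕜 2 f)
    (hinv : ∀ (a : T) (B : Λ → T → V), f (fun μ y => B μ (y - a)) = f B)
    (μ ν : Λ) (a x y : T) (v w : V) :
    fderiv 𝕜 (fderiv 𝕜 f) 0 (Pi.single μ (Pi.single (x + a) v)) (Pi.single ν (Pi.single (y + a) w)) =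
      fderiv 𝕜 (fderiv 𝕜 f) 0 (Pi.single μ (Pi.single x v)) (Pi.single ν (Pi.single y w)) := by
  obtain ⟨τ, hτ⟩ := exists_translateCLM (𝕜 := 𝕜) (Λ := Λ) (V := V) a
  have hτ' : ∀ B, τ B = fun μ y => B μ (y - a) := fun B => funext fun μ => funext fun y => hτ B μ y
  have hinv' : f ∘ τ = f := funext fun B => by rw [Function.comp_apply, hτ', hinv]
  have hs : ∀ (κ : Λ) (z : T) (u : V),
      τ (Pi.single κ (Pi.single z u)) = Pi.single κ (Pi.single (z + a) u) := by
    intro κ z u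
    rw [hτ']
    funext κ' y'
    by_cases hκ : κ' = κ
    · subst hκ
      simp [Pi.single_apply, sub_eq_iff_eq_add]
    · simp [hκ]
  rw [← hs μ x v, ← hs ν y w]
  exact hessian_invariant hf τ hinv' _ _

/-- **(1.21)₁ and (5.8)₂ AT FINITE VOLUME** (print takes (1.21) on the torus `T^{(j+1)}` first and the limit afterwards):
for `𝕜 = ℝ` or `ℂ`, a `C²` function `f` of the bond field `B : Λ → T → V` invariant under all translations (5.3) has a
Hessian kernel `H_{μν}(x, y) = δ²f/δB_μ(x)δB_ν(y)|_{B=0}` (charge direction `v` in both slots) which is a function of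
`x − y`, `H_{μν}(x, y) = H_{μν}(x − y, 0)`, with `H_{μν}(z, 0) = H_{νμ}(−z, 0)`.
[cite: Balaban1987RG1, (1.20)-(1.21) p.264; (5.8) p.293] -/
theorem eq121_finiteVolume [IsRCLikeNormedField 𝕜] {f : (Λ → T → V) → F} (hf : ContDiff 𝕜 2 f)
    (hinv : ∀ (a : T) (B : Λ → T → V), f (fun μ y => B μ (y - a)) = f B) (v : V)
    {H : Λ → Λ → T → T → F}
    (hH : ∀ μ ν x y,
      H μ ν x y = fderiv 𝕜 (fderiv 𝕜 f) 0 (Pi.single μ (Pi.single x v)) (Pi.single ν (Pi.single y v))) :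
    (∀ μ ν a x y, H μ ν (x + a) (y + a) = H μ ν x y) ∧ (∀ μ ν x y, H μ ν x y = H ν μ y x) ∧
      (∀ μ ν x y, H μ ν x y = H μ ν (x - y) 0) ∧ ∀ μ ν z, H μ ν z 0 = H ν μ (-z) 0 := by
  have hT : ∀ μ ν a x y, H μ ν (x + a) (y + a) = H μ ν x y := fun μ ν a x y => by
    rw [hH, hH]; exact hessian_translate_pi hf hinv μ ν a x y v v
  have hS : ∀ μ ν x y, H μ ν x y = H ν μ y x := fun μ ν x y => by
    rw [hH, hH]; exact hessian_swap hf.contDiffAt _ _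
  exact ⟨hT, hS, fun μ ν => apply_eq_apply_sub_zero (hT μ ν), swap_kernel hT hS⟩

end Hessian

/-! ## §3 The limit (5.1): finite-volume invariance and symmetry ⇒ (5.8) for the infinite-volume tensor -/

section Limit

variable {G : Type*} [AddCommGroup G] {α : Type*} [TopologicalSpace α] [T2Space α]
  {ι : Type*} {l : Filter ι} [l.NeBot] {Λ : Type*} {Tn : ι → Type*} [∀ n, AddCommGroup (Tn n)]

/-- **(5.1) + (5.4)-for-translations + Hessian symmetry ⇒ «Π is translation invariant and symmetric»**: if the
finite-volume tensors `Πv n` on the tori `Tn n` are translation invariant and symmetric, and the infinite-volume tensor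
is their pointwise limit (5.1) through the projections `π n : Z^d →+ Tn n` (NAMED HYPOTHESIS `hlim`, along any
non-trivial filter of volumes), then `Π` is translation invariant and symmetric on `Z^d`.
[cite: Balaban1987RG1, (5.1)-(5.4) p.292 and (5.8) p.293; (1.21) p.264] -/
theorem transl58_of_limit (π : ∀ n, G →+ Tn n) {Pv : ∀ n, Λ → Λ → Tn n → Tn n → α}
    {P : Λ → Λ → G → G → α} (hTv : ∀ n μ ν b x y, Pv n μ ν (x + b) (y + b) = Pv n μ ν x y)
    (hSv : ∀ n μ ν x y, Pv n μ ν x y = Pv n ν μ y x)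
    (hlim : ∀ μ ν x y, Tendsto (fun n => Pv n μ ν (π n x) (π n y)) l (𝓝 (P μ ν x y))) :
    (∀ μ ν a x y, P μ ν (x + a) (y + a) = P μ ν x y) ∧ ∀ μ ν x y, P μ ν x y = P ν μ y x :=
  ⟨fun μ ν => translationInvariant_of_tendsto (Pn := fun n x y => Pv n μ ν (π n x) (π n y))
      (fun n a x y => translationInvariant_comp (π n) (hTv n μ ν) a x y) (hlim μ ν),
    swap_of_tendsto (Pn := fun n μ ν x y => Pv n μ ν (π n x) (π n y)) (fun n μ ν x y => hSv n μ ν (π n x) (π n y)) hlim⟩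

/-- **(5.8) as printed, for the limit tensor**: «Π_{μν}(x, y) = Π_{μν}(x − y), Π_{μν}(x) = Π_{νμ}(−x)» with the
one-variable kernel `Π_{μν}(z) := Π_{μν}(z, 0)`. [cite: Balaban1987RG1, (5.8) p.293] -/
theorem eq58_of_limit (π : ∀ n, G →+ Tn n) {Pv : ∀ n, Λ → Λ → Tn n → Tn n → α}
    {P : Λ → Λ → G → G → α} (hTv : ∀ n μ ν b x y, Pv n μ ν (x + b) (y + b) = Pv n μ ν x y)
    (hSv : ∀ n μ ν x y, Pv n μ ν x y = Pv n ν μ y x)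
    (hlim : ∀ μ ν x y, Tendsto (fun n => Pv n μ ν (π n x) (π n y)) l (𝓝 (P μ ν x y))) :
    (∀ μ ν x y, P μ ν x y = P μ ν (x - y) 0) ∧ ∀ μ ν z, P μ ν z 0 = P ν μ (-z) 0 := by
  obtain ⟨hT, hS⟩ := transl58_of_limit π hTv hSv hlim
  exact ⟨fun μ ν => apply_eq_apply_sub_zero (hT μ ν), swap_kernel hT hS⟩

end Limit

/-! ## §4 The join on ℤᵈ: the two-variable Π(x, y) of (4.37) and the lineage's one-variable objects -/

section Lattice

variable {d : ℕ}

/-- **(5.10) for the one-variable kernel `K(z) = Π(z, 0)` from a two-point bound** `|Π(x, y)| ≤ Ce^{−δ₁|x − y|₁}`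
(the shape delivered by `…B12Ext436Lattice.twoPoint_latt`), in the lineage's typed form `B12Sec2to5.Decay510`.
[cite: Balaban1987RG1, (5.10) p.293] -/
theorem decay510_kernel_of_twoPoint {P : Pt d → Pt d → ℝ} {C δ₁ : ℝ}
    (hb : ∀ x y, |P x y| ≤ C * Real.exp (-δ₁ * l1 (x - y))) : Decay510 (fun z => P z 0) C δ₁ :=
  fun z => by simpa only [sub_zero] using hb z 0

/-- (5.10) is insensitive to the reflection `z ↦ −z` (`|−z|₁ = |z|₁`): the kernel `z ↦ Π(0, z) = K(−z)` of
`…B12Ext436Lattice.decay510_latt` and `K` obey it simultaneously. [folklore] -/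
theorem decay510_neg_iff {K : Pt d → ℝ} {C δ₁ : ℝ} :
    Decay510 (fun z => K (-z)) C δ₁ ↔ Decay510 K C δ₁ :=
  ⟨fun h z => by simpa only [neg_neg, l1_neg] using h (-z), fun h z => by simpa only [l1_neg] using h (-z)⟩

/-- **(4.37) ⇒ (5.10) for `K(z) = Π(z, 0) = Σ'_{X∈𝐃⁰_j} 𝐄²(X, z, 0)`** on the infinite class 𝐃⁰_j of ℤᵈ, under the
kernel bound of `…B12Ext436Lattice` (δ₀ > 0, κ ≥ 2κ₀(4·2ᵈ, 2d), cubes of side M ≥ 1): `Decay510 K (C_E e^{3Mdδ₁} K₀ K₁(d, δ₀/2)) δ₁`,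
δ₁ = ½ min{δ₀, κ(Md)⁻¹} — the companion of `decay510_latt` (which bounds `z ↦ Π(0, z)`) in the convention `Π(x, y) =
K(x − y)` of (5.8)₁ and of `…B12Moments443`. [cite: Balaban1987RG1, (4.37) p.291 and (5.10) p.293] -/
theorem decay510_tsum437 (hd : 0 < d) {M : ℕ} (hM : 0 < M) {E2 : LDom d → Pt d → Pt d → ℝ} {CE κ δ₀ : ℝ}
    (hCE : 0 ≤ CE) (hδ₀ : 0 < δ₀) (hκ₀ : kappa₀ (4 * 2 ^ d) (2 * d) ≤ κ / 2)
    (hE : (geomZ d M).KernelBound E2 CE κ δ₀) :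
    Decay510 (fun z => ∑' X : LDom d, E2 X z 0)
      (CE * Real.exp (delta1 δ₀ κ ((M : ℝ) * d) * ((M : ℝ) * d) * 3) * K₀ (4 * 2 ^ d) (2 * d) * K₁ d (δ₀ / 2))
      (delta1 δ₀ κ ((M : ℝ) * d)) :=
  decay510_kernel_of_twoPoint (P := fun x y => ∑' X : LDom d, E2 X x y)
    fun x y => (twoPoint_latt hd hM hCE hδ₀ hκ₀ hE x y).2

variable {P : Fin d → Fin d → Pt d → Pt d → ℝ}

/-- **The whole-lattice second-moment coefficient of (4.34) for the two-variable Π IS `B12Moments443.M2x` of the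
one-variable kernel** `K_{μν}(z) = Π_{μν}(z, 0)` (read in ℂ through `ofRealK`), under translation invariance:
`Σ_y Π_{μν}(x, y)(y_κ − x_κ)(y_λ − x_λ) = Σ_y K_{μν}(x − y)(y_κ − x_κ)(y_λ − x_λ)`.
[cite: Balaban1987RG1, (4.34) p.289, (4.37)/(4.43) p.291, (5.8) p.293] -/
theorem ofReal_tsum_moment2_eq_M2x (hT : ∀ μ ν a x y, P μ ν (x + a) (y + a) = P μ ν x y) (x : Pt d)
    (μ ν κ l : Fin d) :
    ((∑' y, P μ ν x y * (((y κ - x κ : ℤ) : ℝ) * ((y l - x l : ℤ) : ℝ)) : ℝ) : ℂ) =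
      M2x (ofRealK fun μ ν z => P μ ν z 0) x μ ν κ l := by
  rw [Complex.ofReal_tsum]
  simp only [M2x, ofRealK, ofReal]
  refine tsum_congr fun y => ?_
  rw [apply_eq_apply_sub_zero (hT μ ν) x y]
  push_cast
  ring

/-- The same for the first-moment coefficient: `Σ_y Π_{μν}(x, y)(y_κ − x_κ) = B12Moments443.M1x (ofRealK K) x μ ν κ`.
[cite: Balaban1987RG1, (4.34) p.289, (4.45) p.292, (5.8) p.293] -/
theorem ofReal_tsum_moment1_eq_M1x (hT : ∀ μ ν a x y, P μ ν (x + a) (y + a) = P μ ν x y) (x : Pt d)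
    (μ ν κ : Fin d) :
    (((∑' y, P μ ν x y * ((y κ - x κ : ℤ) : ℝ)) : ℝ) : ℂ) = M1x (ofRealK fun μ ν z => P μ ν z 0) x μ ν κ := by
  rw [Complex.ofReal_tsum]
  simp only [M1x, ofRealK, ofReal]
  refine tsum_congr fun y => ?_
  rw [apply_eq_apply_sub_zero (hT μ ν) x y]
  push_cast
  ring

/-- The same for the zeroth coefficient: `Σ_y Π_{μν}(x, y) = B12Moments443.M0x (ofRealK K) x μ ν`.
[cite: Balaban1987RG1, (4.34) p.289, (5.8) p.293] -/
theorem ofReal_tsum_moment0_eq_M0x (hT : ∀ μ ν a x y, P μ ν (x + a) (y + a) = P μ ν x y) (x : Pt d)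
    (μ ν : Fin d) :
    (((∑' y, P μ ν x y) : ℝ) : ℂ) = M0x (ofRealK fun μ ν z => P μ ν z 0) x μ ν := by
  rw [Complex.ofReal_tsum]
  simp only [M0x, ofRealK, ofReal]
  refine tsum_congr fun y => ?_
  rw [apply_eq_apply_sub_zero (hT μ ν) x y]

/-- The lineage's two Kronecker deltas over `ℝ` and `ℂ` agree under the cast. [folklore] -/
theorem ofReal_kdA (i j : Fin d) : ((kdA (A := ℝ) i j : ℝ) : ℂ) = kdA (A := ℂ) i j := by
  unfold kdA
  split_ifs <;> simp

variable {C₁ δ₁ : ℝ} {μ₀ ν₀ : Fin d}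

/-- **(4.43) FOR THE TWO-VARIABLE Π(x, y)**, as a real identity: translation invariance (5.8)₁ + for the one-variable
kernel `K_{μν}(z) = Π_{μν}(z, 0)` the decay (5.10), the covariances (5.6) `PermCovariant`, (5.7) `ReflCovariant` and the
Ward identity (5.9)₁ `WardFirst` ⇒ for every `x`:
`Σ_{y∈Z^d} Π_{μν}(x, y)(y_κ − x_κ)(y_λ − x_λ) = β(δ_{μκ}δ_{νλ} + δ_{μλ}δ_{νκ} − 2δ_{μν}δ_{κλ})`, `β = Σ_z K_{μ₀ν₀}(z)z_{μ₀}z_{ν₀}`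
(`B12Beta.secondMoment`, any `μ₀ ≠ ν₀`; = (5.42) = (1.22)) — `…B12Moments443.moments443_of_symmetries` transported.
[cite: Balaban1987RG1, (4.43) p.291; (5.8)-(5.10) p.293; (5.42) p.297] -/
theorem moment2_eq_of_symmetries (hT : ∀ μ ν a x y, P μ ν (x + a) (y + a) = P μ ν x y) (hδ : 0 < δ₁)
    (h510 : ∀ μ ν, Decay510 (fun z => P μ ν z 0) C₁ δ₁)
    (hperm : B12Beta.PermCovariant fun μ ν z => P μ ν z 0) (hrefl : ReflCovariant fun μ ν z => P μ ν z 0)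
    (hward : WardFirst fun μ ν z => P μ ν z 0) (h0 : μ₀ ≠ ν₀) (x : Pt d) (μ ν κ l : Fin d) :
    ∑' y, P μ ν x y * (((y κ - x κ : ℤ) : ℝ) * ((y l - x l : ℤ) : ℝ)) =
      B12Beta.secondMoment (fun μ ν z => P μ ν z 0) μ₀ ν₀ *
        (kdA μ κ * kdA ν l + kdA μ l * kdA ν κ - 2 * kdA μ ν * kdA κ l) := by
  have h := (ofReal_tsum_moment2_eq_M2x hT x μ ν κ l).trans
    (moments443_of_symmetries (P := fun μ ν z => P μ ν z 0) hδ h510 hperm hrefl hward h0 x μ ν κ l)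
  simp only [← ofReal_kdA] at h
  exact_mod_cast h

/-- **(4.45) FOR THE TWO-VARIABLE Π(x, y)**: `Σ_{y∈Z^d} Π_{μν}(x, y)(y_κ − x_κ) = 0` («hence this term vanishes»), from
the same hypotheses. [cite: Balaban1987RG1, (4.45) p.292; (5.8)-(5.10) p.293] -/
theorem moment1_eq_zero_of_symmetries (hT : ∀ μ ν a x y, P μ ν (x + a) (y + a) = P μ ν x y) (hδ : 0 < δ₁)
    (h510 : ∀ μ ν, Decay510 (fun z => P μ ν z 0) C₁ δ₁)
    (hperm : B12Beta.PermCovariant fun μ ν z => P μ ν z 0) (hrefl : ReflCovariant fun μ ν z => P μ ν z 0)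
    (hward : WardFirst fun μ ν z => P μ ν z 0) (h0 : μ₀ ≠ ν₀) (x : Pt d) (μ ν κ : Fin d) :
    ∑' y, P μ ν x y * ((y κ - x κ : ℤ) : ℝ) = 0 := by
  have h := (ofReal_tsum_moment1_eq_M1x hT x μ ν κ).trans
    (moments445_of_symmetries (P := fun μ ν z => P μ ν z 0) hδ h510 hperm hrefl hward h0 x μ ν κ)
  exact_mod_cast h

/-- **No mass term FOR THE TWO-VARIABLE Π(x, y)**: `Σ_{y∈Z^d} Π_{μν}(x, y) = 0` (whole-lattice value `Π̃_{μν}(0) = 0`,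
(5.16)), from the same hypotheses. [cite: Balaban1987RG1, (5.16) p.293; (5.8)-(5.10) p.293] -/
theorem moment0_eq_zero_of_symmetries (hT : ∀ μ ν a x y, P μ ν (x + a) (y + a) = P μ ν x y) (hδ : 0 < δ₁)
    (h510 : ∀ μ ν, Decay510 (fun z => P μ ν z 0) C₁ δ₁)
    (hperm : B12Beta.PermCovariant fun μ ν z => P μ ν z 0) (hrefl : ReflCovariant fun μ ν z => P μ ν z 0)
    (hward : WardFirst fun μ ν z => P μ ν z 0) (h0 : μ₀ ≠ ν₀) (x : Pt d) (μ ν : Fin d) :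
    ∑' y, P μ ν x y = 0 := by
  have h := (ofReal_tsum_moment0_eq_M0x hT x μ ν).trans
    (moments0_of_symmetries (P := fun μ ν z => P μ ν z 0) hδ h510 hperm hrefl hward h0 x μ ν)
  exact_mod_cast h

/-- **Plug lemma for the p. 290/291 chain, second moments**: any real `A` within `ε` of the whole-lattice coefficient
`Σ_y Π_{μν}(x, y)(y_κ − x_κ)(y_λ − x_λ)` is within `ε` of `β(δ_{μκ}δ_{νλ} + δ_{μλ}δ_{νκ} − 2δ_{μν}δ_{κλ})`.  With `A` the
restricted sum `Σ'_{X⊂□̃²}Σ_{y∈supp ζ̃}𝐄²₀(X, x, y)(y − x)_κ(y − x)_λ` and `ε` the three-term bound of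
`…B12Chain290.chain290_moment2` (whose right member is exactly this coefficient for `Π(x, y) = Σ'_{X∈𝐃⁰_j}𝐄²(X, x, y)`),
this is p. 292 «The corresponding terms from (4.34) are equal to (4.42), (4.44) also» up to the exponentially small
coefficients of p. 290, now for print's two-variable Π itself. [cite: Balaban1987RG1, p.290-292, (4.43) p.291, (5.8) p.293] -/
theorem abs_sub_moment2_le_of_symmetries (hT : ∀ μ ν a x y, P μ ν (x + a) (y + a) = P μ ν x y) (hδ : 0 < δ₁)
    (h510 : ∀ μ ν, Decay510 (fun z => P μ ν z 0) C₁ δ₁)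
    (hperm : B12Beta.PermCovariant fun μ ν z => P μ ν z 0) (hrefl : ReflCovariant fun μ ν z => P μ ν z 0)
    (hward : WardFirst fun μ ν z => P μ ν z 0) (h0 : μ₀ ≠ ν₀) {A ε : ℝ} {x : Pt d} {μ ν κ l : Fin d}
    (hA : |A - ∑' y, P μ ν x y * (((y κ - x κ : ℤ) : ℝ) * ((y l - x l : ℤ) : ℝ))| ≤ ε) :
    |A - B12Beta.secondMoment (fun μ ν z => P μ ν z 0) μ₀ ν₀ *
        (kdA μ κ * kdA ν l + kdA μ l * kdA ν κ - 2 * kdA μ ν * kdA κ l)| ≤ ε := by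
  rwa [moment2_eq_of_symmetries hT hδ h510 hperm hrefl hward h0 x μ ν κ l] at hA

/-- **Plug lemma, first moments**: any real `A` within `ε` of `Σ_y Π_{μν}(x, y)(y_κ − x_κ)` has `|A| ≤ ε` («hence this
term vanishes», p. 292 after (4.45), up to the exponentially small coefficients; `A`, `ε` as in
`…B12Chain290.chain290_moment1`). [cite: Balaban1987RG1, p.290-292, (4.45) p.292, (5.8) p.293] -/
theorem abs_moment1_le_of_symmetries (hT : ∀ μ ν a x y, P μ ν (x + a) (y + a) = P μ ν x y) (hδ : 0 < δ₁)
    (h510 : ∀ μ ν, Decay510 (fun z => P μ ν z 0) C₁ δ₁)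
    (hperm : B12Beta.PermCovariant fun μ ν z => P μ ν z 0) (hrefl : ReflCovariant fun μ ν z => P μ ν z 0)
    (hward : WardFirst fun μ ν z => P μ ν z 0) (h0 : μ₀ ≠ ν₀) {A ε : ℝ} {x : Pt d} {μ ν κ : Fin d}
    (hA : |A - ∑' y, P μ ν x y * ((y κ - x κ : ℤ) : ℝ)| ≤ ε) : |A| ≤ ε := by
  rwa [moment1_eq_zero_of_symmetries hT hδ h510 hperm hrefl hward h0 x μ ν κ, sub_zero] at hA

/-- **Plug lemma, zeroth moments**: any real `A` within `ε` of `Σ_y Π_{μν}(x, y)` has `|A| ≤ ε` (no mass term, up to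
the exponentially small coefficients; `A`, `ε` as in `…B12Chain290.chain290_moment0`).
[cite: Balaban1987RG1, p.290-291, (5.16) p.293, (5.8) p.293] -/
theorem abs_moment0_le_of_symmetries (hT : ∀ μ ν a x y, P μ ν (x + a) (y + a) = P μ ν x y) (hδ : 0 < δ₁)
    (h510 : ∀ μ ν, Decay510 (fun z => P μ ν z 0) C₁ δ₁)
    (hperm : B12Beta.PermCovariant fun μ ν z => P μ ν z 0) (hrefl : ReflCovariant fun μ ν z => P μ ν z 0)
    (hward : WardFirst fun μ ν z => P μ ν z 0) (h0 : μ₀ ≠ ν₀) {A ε : ℝ} {x : Pt d} {μ ν : Fin d}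
    (hA : |A - ∑' y, P μ ν x y| ≤ ε) : |A| ≤ ε := by
  rwa [moment0_eq_zero_of_symmetries hT hδ h510 hperm hrefl hward h0 x μ ν, sub_zero] at hA

/-- **END TO END: (5.1) + (5.2)-for-translations + Hessian symmetry at finite volume + the §5 symmetries and decay of
the one-variable kernel ⇒ (4.43) for the two-variable infinite-volume tensor.**  The finite-volume tensors `Πv n` on
tori `Tn n` (translation invariant, symmetric), their pointwise limit `Π` on `Z^d` through `π n : Z^d →+ Tn n` ((5.1),
hypothesis `hlim`), and for `K_{μν}(z) = Π_{μν}(z, 0)` the printed (5.10), (5.6), (5.7), (5.9)₁ give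
`Σ_y Π_{μν}(x, y)(y_κ − x_κ)(y_λ − x_λ) = β(δ_{μκ}δ_{νλ} + δ_{μλ}δ_{νκ} − 2δ_{μν}δ_{κλ})` and `K_{μν}(z) = K_{νμ}(−z)` ((5.8)₂).
[cite: Balaban1987RG1, (5.1)-(5.4) p.292, (5.8)-(5.10) p.293, (4.43) p.291, (5.42) p.297] -/
theorem moment2_eq_of_limit {ι : Type*} {l : Filter ι} [l.NeBot] {Tn : ι → Type*} [∀ n, AddCommGroup (Tn n)]
    (π : ∀ n, Pt d →+ Tn n) {Pv : ∀ n, Fin d → Fin d → Tn n → Tn n → ℝ}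
    (hTv : ∀ n μ ν b x y, Pv n μ ν (x + b) (y + b) = Pv n μ ν x y)
    (hSv : ∀ n μ ν x y, Pv n μ ν x y = Pv n ν μ y x)
    (hlim : ∀ μ ν x y, Tendsto (fun n => Pv n μ ν (π n x) (π n y)) l (𝓝 (P μ ν x y))) (hδ : 0 < δ₁)
    (h510 : ∀ μ ν, Decay510 (fun z => P μ ν z 0) C₁ δ₁)
    (hperm : B12Beta.PermCovariant fun μ ν z => P μ ν z 0) (hrefl : ReflCovariant fun μ ν z => P μ ν z 0)
    (hward : WardFirst fun μ ν z => P μ ν z 0) (h0 : μ₀ ≠ ν₀) (x : Pt d) (μ ν κ l : Fin d) :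
    ∑' y, P μ ν x y * (((y κ - x κ : ℤ) : ℝ) * ((y l - x l : ℤ) : ℝ)) =
        B12Beta.secondMoment (fun μ ν z => P μ ν z 0) μ₀ ν₀ *
          (kdA μ κ * kdA ν l + kdA μ l * kdA ν κ - 2 * kdA μ ν * kdA κ l) ∧
      ∀ μ ν z, P μ ν z 0 = P ν μ (-z) 0 := by
  obtain ⟨hT, hS⟩ := transl58_of_limit π hTv hSv hlim
  exact ⟨moment2_eq_of_symmetries hT hδ h510 hperm hrefl hward h0 x μ ν κ l, swap_kernel hT hS⟩

end Lattice

end Literature.MathematicalPhysics.QuantumFieldTheory.Balaban1983to89.B12Transl58
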